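import Literature.Computability.AlgebraicComplexity.MignonRessayreBound
import Mathlib.RingTheory.MvPolynomial.Homogeneous
import Mathlib.LinearAlgebra.Matrix.Rank

/-!
# Route `RefutationDegree`, item `MrCalibration` (stmt-ValiantsHypothesis-5647) — generic lemmas

Helper file (no definitions) for the proof that the Mignon–Ressayre bound is a Nullstellensatz
refutation of degree `O(m²)` of the system `Rep(n,m)` ("`per_n = det (A₀ + Σ x_e A_e)`").
Contents, all folklore:

* minors: an invertible matrix over a field has a non-zero `k × k` minor for every `k ≤ card`
  (`exists_submatrix_det_ne_zero`, Laplace expansion), and all `k × k` minors of a matrix of rank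
  `< k` vanish (`det_submatrix_eq_zero_of_rank_lt`);
* degrees: `deg det N ≤ card · d` for entries of degree `≤ d` (`totalDegree_det_le`), homogeneity of
  such determinants (`isHomogeneous_det`), and the same bookkeeping for the COEFFICIENTS of
  polynomials in `x` over a polynomial ring `R = K[a]` (`coeffDeg_*`: if every `x`-coefficient of
  `p`, `q` has `a`-degree `≤ a`, `≤ b`, then those of `p q` have degree `≤ a + b`, etc.);
* naturality of the Hessian-at-the-origin vocabulary of `HessianAtOrigin.lean` under a change of
  scalars (`hess0_map`, `map_transl`), the expansion of `hess0 (transl x p)` along the coefficients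
  of `p` (`hess0_transl_eq_sum`), and the entries of `hess0` as coefficients
  (`totalDegree_hess0_apply_le`).

References: T. Mignon, N. Ressayre, IMRN 2004 (Thm. 1.1); J. M. Landsberg, *Geometry and Complexity
Theory* (2017), §6.4.
-/

noncomputable section

-- single-conjunct layout: Sub = Summit, duplicated namespace component intended
set_option linter.dupNamespace false

namespace Summit.ValiantsHypothesis.ValiantsHypothesis.Theorems.RefutationDegreeMrCalibration

open MvPolynomial Matrix Literature.Computability.AlgebraicComplexity

/-! ### Minors of invertible and of low-rank matrices -/

section Minors

variable {K : Type*} [Field K] {ι : Type*} [Fintype ι] [DecidableEq ι]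

/-- A matrix with non-zero determinant has a non-vanishing `k × k` minor for every
`k ≤ card ι` (downward induction on `k` by Laplace expansion along the first row). [folklore] -/
theorem exists_submatrix_det_ne_zero_aux (N : Matrix ι ι K) (hN : N.det ≠ 0) :
    ∀ d k : ℕ, k + d = Fintype.card ι → ∃ r c : Fin k → ι, (N.submatrix r c).det ≠ 0 := by
  intro d
  induction d with
  | zero =>
      intro k hk
      rw [add_zero] at hk
      let e : Fin k ≃ ι := (Fintype.equivFinOfCardEq hk.symm).symm
      refine ⟨e, e, ?_⟩
      rwa [Matrix.det_submatrix_equiv_self]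
  | succ d ih =>
      intro k hk
      obtain ⟨r, c, h⟩ := ih (k + 1) (by omega)
      rw [Matrix.det_succ_row_zero] at h
      obtain ⟨j, -, hj⟩ := Finset.exists_ne_zero_of_sum_ne_zero h
      refine ⟨r ∘ Fin.succ, c ∘ j.succAbove, ?_⟩
      intro h0
      apply hj
      have : (N.submatrix r c).submatrix Fin.succ j.succAbove =
          N.submatrix (r ∘ Fin.succ) (c ∘ j.succAbove) := by
        rw [Matrix.submatrix_submatrix]
      rw [this, h0, mul_zero]

/-- An invertible matrix over a field has a non-vanishing `k × k` minor for every `k ≤ card ι`.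
[folklore] -/
theorem exists_submatrix_det_ne_zero (N : Matrix ι ι K) (hN : IsUnit N) {k : ℕ}
    (hk : k ≤ Fintype.card ι) : ∃ r c : Fin k → ι, (N.submatrix r c).det ≠ 0 :=
  exists_submatrix_det_ne_zero_aux N ((Matrix.isUnit_iff_isUnit_det N).mp hN).ne_zero
    (Fintype.card ι - k) k (by omega)

omit [DecidableEq ι] in
/-- All `k × k` minors of a matrix of rank `< k` over a field vanish. [folklore] -/
theorem det_submatrix_eq_zero_of_rank_lt (N : Matrix ι ι K) {k : ℕ}
    (hN : N.rank < k) (r c : Fin k → ι) : (N.submatrix r c).det = 0 := by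
  by_contra h
  have hu : IsUnit (N.submatrix r c) :=
    (Matrix.isUnit_iff_isUnit_det _).mpr (isUnit_iff_ne_zero.mpr h)
  have h1 := Matrix.rank_of_isUnit _ hu
  have h2 := Matrix.rank_submatrix_le N r c
  rw [Fintype.card_fin] at h1
  omega

end Minors

/-! ### Degree and homogeneity of determinants of polynomial matrices -/

section DetDegree

variable {R : Type*} [CommRing R] {σ : Type*} {ι : Type*} [Fintype ι] [DecidableEq ι]

/-- `deg det N ≤ card ι · d` if all entries of `N` have total degree `≤ d`. [folklore] -/
theorem totalDegree_det_le (N : Matrix ι ι (MvPolynomial σ R)) {d : ℕ}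
    (h : ∀ i j, (N i j).totalDegree ≤ d) : N.det.totalDegree ≤ Fintype.card ι * d := by
  rw [Matrix.det_apply]
  refine totalDegree_finsetSum_le fun π _ => ?_
  rw [Units.smul_def, zsmul_eq_mul, ← map_intCast (C : R →+* MvPolynomial σ R)]
  refine (totalDegree_mul _ _).trans ?_
  rw [totalDegree_C, zero_add]
  refine (totalDegree_finsetProd _ _).trans ?_
  calc ∑ i, (N (π i) i).totalDegree ≤ ∑ _i : ι, d := Finset.sum_le_sum fun i _ => h _ _
    _ = Fintype.card ι * d := by simp

/-- The determinant of a square matrix whose entries are homogeneous of degree `d` is homogeneous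
of degree `card ι · d`. [folklore] -/
theorem isHomogeneous_det (N : Matrix ι ι (MvPolynomial σ R)) {d : ℕ}
    (h : ∀ i j, (N i j).IsHomogeneous d) : N.det.IsHomogeneous (Fintype.card ι * d) := by
  rw [Matrix.det_apply]
  refine IsHomogeneous.sum _ _ _ fun π _ => ?_
  have hp := IsHomogeneous.prod (φ := fun i : ι => N (π i) i) Finset.univ (fun _ => d)
    fun i _ => h (π i) i
  rw [Units.smul_def, zsmul_eq_mul, ← map_intCast (C : R →+* MvPolynomial σ R)]
  simp only [Finset.sum_const, smul_eq_mul, Finset.card_univ] at hp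
  simpa only [zero_add] using (isHomogeneous_C _ _).mul hp

end DetDegree

/-! ### Degrees of the coefficients of polynomials over a polynomial ring -/

section CoeffDegree

variable {R : Type*} [CommRing R] {σ τ : Type*}

/-- Coefficient degrees of a product. [folklore] -/
theorem coeffDeg_mul {p q : MvPolynomial τ (MvPolynomial σ R)} {a b : ℕ}
    (hp : ∀ μ, (coeff μ p).totalDegree ≤ a) (hq : ∀ μ, (coeff μ q).totalDegree ≤ b)
    (μ : τ →₀ ℕ) : (coeff μ (p * q)).totalDegree ≤ a + b := by
  classical
  rw [coeff_mul]
  exact totalDegree_finsetSum_le fun x _ => (totalDegree_mul _ _).trans (add_le_add (hp _) (hq _))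

/-- Coefficient degrees of a sum. [folklore] -/
theorem coeffDeg_add {p q : MvPolynomial τ (MvPolynomial σ R)} {d : ℕ}
    (hp : ∀ μ, (coeff μ p).totalDegree ≤ d) (hq : ∀ μ, (coeff μ q).totalDegree ≤ d)
    (μ : τ →₀ ℕ) : (coeff μ (p + q)).totalDegree ≤ d := by
  rw [coeff_add]
  exact (totalDegree_add _ _).trans (max_le (hp μ) (hq μ))

/-- Coefficient degrees of a difference. [folklore] -/
theorem coeffDeg_sub {p q : MvPolynomial τ (MvPolynomial σ R)} {d : ℕ}
    (hp : ∀ μ, (coeff μ p).totalDegree ≤ d) (hq : ∀ μ, (coeff μ q).totalDegree ≤ d)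
    (μ : τ →₀ ℕ) : (coeff μ (p - q)).totalDegree ≤ d := by
  rw [coeff_sub]
  exact (totalDegree_sub _ _).trans (max_le (hp μ) (hq μ))

/-- Coefficient degrees of a finite sum. [folklore] -/
theorem coeffDeg_sum {ι : Type*} (s : Finset ι) (f : ι → MvPolynomial τ (MvPolynomial σ R))
    {d : ℕ} (h : ∀ i ∈ s, ∀ μ, (coeff μ (f i)).totalDegree ≤ d) (μ : τ →₀ ℕ) :
    (coeff μ (∑ i ∈ s, f i)).totalDegree ≤ d := by
  rw [coeff_sum]
  exact totalDegree_finsetSum_le fun i hi => h i hi μ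

/-- Coefficient degrees of a finite product. [folklore] -/
theorem coeffDeg_prod {ι : Type*} [DecidableEq ι] (s : Finset ι)
    (f : ι → MvPolynomial τ (MvPolynomial σ R)) (d : ι → ℕ)
    (h : ∀ i ∈ s, ∀ μ, (coeff μ (f i)).totalDegree ≤ d i) :
    ∀ μ : τ →₀ ℕ, (coeff μ (∏ i ∈ s, f i)).totalDegree ≤ ∑ i ∈ s, d i := by
  classical
  induction s using Finset.induction_on with
  | empty =>
      intro μ
      rw [Finset.prod_empty, Finset.sum_empty, coeff_one]
      split_ifs
      · rw [totalDegree_one]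
      · rw [totalDegree_zero]
  | insert a s ha ih =>
      intro μ
      rw [Finset.prod_insert ha, Finset.sum_insert ha]
      exact coeffDeg_mul (h a (Finset.mem_insert_self a s))
        (ih fun i hi => h i (Finset.mem_insert_of_mem hi)) μ

/-- Coefficient degrees of a constant. [folklore] -/
theorem coeffDeg_C (c : MvPolynomial σ R) {d : ℕ} (hc : c.totalDegree ≤ d) (μ : τ →₀ ℕ) :
    (coeff μ (C c : MvPolynomial τ (MvPolynomial σ R))).totalDegree ≤ d := by
  classical
  rw [coeff_C]
  split_ifs
  · exact hc
  · rw [totalDegree_zero]; exact Nat.zero_le _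

/-- Coefficient degrees of `X e · C c`. [folklore] -/
theorem coeffDeg_X_mul_C (e : τ) (c : MvPolynomial σ R) {d : ℕ} (hc : c.totalDegree ≤ d)
    (μ : τ →₀ ℕ) : (coeff μ (X e * C c : MvPolynomial τ (MvPolynomial σ R))).totalDegree ≤ d := by
  classical
  rw [X, mul_comm, C_mul_monomial, mul_one, coeff_monomial]
  split_ifs
  · exact hc
  · rw [totalDegree_zero]; exact Nat.zero_le _

/-- Coefficient degrees of `map C q` (all coefficients are constants). [folklore] -/
theorem coeffDeg_map_C (q : MvPolynomial τ R) (μ : τ →₀ ℕ) :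
    (coeff μ (map (C : R →+* MvPolynomial σ R) q)).totalDegree ≤ 0 := by
  rw [coeff_map, totalDegree_C]

/-- Coefficient degrees of a determinant. [folklore] -/
theorem coeffDeg_det {ι : Type*} [Fintype ι] [DecidableEq ι]
    (N : Matrix ι ι (MvPolynomial τ (MvPolynomial σ R))) {d : ℕ}
    (h : ∀ i j μ, (coeff μ (N i j)).totalDegree ≤ d) (μ : τ →₀ ℕ) :
    (coeff μ N.det).totalDegree ≤ Fintype.card ι * d := by
  rw [Matrix.det_apply]
  refine coeffDeg_sum _ _ (fun π _ ν => ?_) μ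
  rw [Units.smul_def, zsmul_eq_mul,
    ← map_intCast (C : MvPolynomial σ R →+* MvPolynomial τ (MvPolynomial σ R)), coeff_C_mul]
  refine (totalDegree_mul _ _).trans ?_
  rw [← map_intCast (C : R →+* MvPolynomial σ R), totalDegree_C, zero_add]
  have := coeffDeg_prod Finset.univ (fun i => N (π i) i) (fun _ => d) (fun i _ => h (π i) i) ν
  simpa using this

/-- The entries of the Hessian at the origin are (integer multiples of) coefficients, so their
degree is bounded by the degrees of the coefficients. [folklore] -/
theorem totalDegree_hess0_apply_le (p : MvPolynomial τ (MvPolynomial σ R)) (s t : τ) {d : ℕ}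
    (hp : ∀ μ, (coeff μ p).totalDegree ≤ d) : (hess0 p s t).totalDegree ≤ d := by
  rw [hess0_apply]
  show (coeff 0 (pderiv s (pderiv t p))).totalDegree ≤ d
  rw [coeff_pderiv, coeff_pderiv, zero_add]
  have hc : ∀ a : ℕ, ((a : MvPolynomial σ R) + 1).totalDegree = 0 := fun a => by
    rw [← Nat.cast_one, ← Nat.cast_add, ← map_natCast (C : R →+* MvPolynomial σ R),
      totalDegree_C]
  refine (totalDegree_mul _ _).trans ?_
  rw [hc ((0 : τ →₀ ℕ) s), add_zero]
  refine (totalDegree_mul _ _).trans ?_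
  rw [hc, add_zero]
  exact hp _

end CoeffDegree

/-! ### Naturality of `hess0` and `transl` -/

section Naturality

variable {k k' : Type*} [CommRing k] [CommRing k'] {σ : Type*}

/-- `hess0` commutes with a change of scalars. [folklore] -/
theorem hess0_map (f : k →+* k') (p : MvPolynomial σ k) :
    hess0 (map f p) = (hess0 p).map f := by
  ext s t
  simp only [hess0_apply, Matrix.map_apply, pderiv_map, constantCoeff_map]

/-- `transl` commutes with a change of scalars. [folklore] -/
theorem map_transl (f : k →+* k') (x : σ → k) (p : MvPolynomial σ k) :
    map f (transl x p) = transl (f ∘ x) (map f p) := by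
  induction p using MvPolynomial.induction_on with
  | C a => simp
  | add p q hp hq => simp only [map_add, hp, hq]
  | mul_X p i hp => simp [hp]

/-- The Hessian of a translate, expanded along the coefficients:
`H(p(X + x))(0) = Σ_μ coeff_μ(p) · H(X^μ (X + x))(0)`. [folklore] -/
theorem hess0_transl_eq_sum (x : σ → k) (p : MvPolynomial σ k) :
    hess0 (transl x p) = ∑ μ ∈ p.support, p.coeff μ • hess0 (transl x (monomial μ 1)) := by
  conv_lhs => rw [p.as_sum]
  rw [map_sum, map_sum]
  refine Finset.sum_congr rfl fun μ _ => ?_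
  rw [show monomial μ (coeff μ p) = coeff μ p • monomial μ 1 by
      rw [smul_monomial, smul_eq_mul, mul_one],
    map_smul, map_smul]

/-- The Hessian at the origin of the translate of a monomial with coefficient `1` by a point with
coordinates in the image of `C` has constant entries. [folklore] -/
theorem hess0_transl_monomial_map (f : k →+* k') (x : σ → k) (μ : σ →₀ ℕ) :
    hess0 (transl (f ∘ x) (monomial μ (1 : k'))) = (hess0 (transl x (monomial μ (1 : k)))).map f := by
  have h : map f (monomial μ (1 : k)) = monomial μ (1 : k') := by
    rw [map_monomial, map_one f]
  rw [← h, ← map_transl, hess0_map]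

end Naturality

end Summit.ValiantsHypothesis.ValiantsHypothesis.Theorems.RefutationDegreeMrCalibration
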